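import Literature.MathematicalPhysics.QuantumFieldTheory.Balaban1983to89.B9Thm31SiteGsqCutoffFactorsReg335Y
import Literature.MathematicalPhysics.QuantumFieldTheory.Balaban1983to89.B9Eq346GradGpDivTorusL2

/-!
# `Balaban1983to89.B9Thm31SiteGsqBlockDistReg335Y` — T. Bałaban, *Propagators for lattice gauge theories in a background field*, Commun. Math. Phys.
# **99** (1985) 389–434 [Balaban1985BackgroundPropagators] Cor 3.6 p. 408 ∕ (3.46) p. 398 ∕ (3.88)–(3.89) p. 409, with [B6] = [Balaban1984PropagatorsII] (2.46) p. 231: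
# ★★★ **THE `L²` MEMBERS OF FILES 21–23 FOR THE GENUINE LOCAL CUBE INVERSES `G′_□(U)` WITH PRINT'S RATE IN THE BLOCK DISTANCE `d(y,y′)`** — the Agmon
# weight instantiated at dag-n06-j's multi-scale exponent `msRhoT` ∕ dag-n06-w7's shifted exponent `ρ⁺_s = max(ρ_s − 1, 0)`: source block `s`, output in blocks at
# block distance `≥ n` (file 24 of the site-sector set of width seat `pub-ymgap-dag-n06-w1`; the block-to-block shapes dag-n06-d's FILE C reads)

statement-level skeleton of published theorems with citation tags; proofs where landed; nothing here is a claim about the Yang–Mills mass gap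

THE PRINT (verbatim).  p. 398, (3.46): the six `L²` members with `e^{−δ₀d(y,y′)}`, *«for supp h ⊂ Δ(y), y ∈ Λ_j, supp λ ⊂ Δ(y′)»*; p. 397: `d(y,y′)` = [B6] (2.46)'s block
distance; p. 408, Cor 3.6 («constants independent of □»); p. 409, (3.89) (`K(h_□)G′_□h_□`, `O(M⁻¹)e^{−δ₀(Lʲη)⁻¹|y−y′|}`).

WHY THIS FILE (cell `pub-ymgap`, node N06 [B9], width seat `pub-ymgap-dag-n06-w1`, gen 3).  Files 21–23 state the (3.46) members of `G′_□(U) = GsqY i (parSymY i) D U`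
for an ARBITRARY admissible Agmon weight; the walk's legs (dag-n06-k `L2MixedLegs37`, `FactorsL2Mixed37`; dag-n06-d FILE C) read them BLOCK TO BLOCK with print's rate.
THIS FILE does the instantiation once: the source `λ` carried by a block `s` of `𝔅` (so `∇*_μλ`, `M_h∇*_μλ` live on `Δ(s) ∪ (Δ(s) + e_μ)`, where dag-n06-w7's
`ρ⁺_s` vanishes: `msRhoYPos_eq_zero ∕ _shift`, and whose levels are `≤ lev s + 1`: `lev_adj_le`), the output set `A` in blocks at block distance `≥ n` from `s`
(`msRhoY(Pos)_ge_of_le`), and — for the `K(h_□)`-factor, whose weight must also cover the backward neighbours of the output — the output block `Δ(t)` with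
`d(t,s) ≥ n`, its neighbours lying at distance `≥ n − 1` (`distT_shiftY_symm_ge`, from `distT_blkOf_le_one_of_adj` and the triangle inequality of `bondT`).

WHAT IS PROVED (sorry-free; 0 `def`).  On the class `(bg9K (M_N ℂ) G i).Reg335 c α₀`, `G ≤ U(N)`, `N ≥ 1`, `0 ≤ c·M·α₀`, `c·M·α₀·(d+1) ≤ 1∕16`, every site set `D`,
`δ₀ = 1∕(4(d+2))`, rates `W = e^{δ₀(n−1)∕(2L)}` (plain exponent) ∕ `e^{δ₀((n−1)∕(2L) − 1)}` (shifted) ∕ `e^{δ₀((n−2)∕(2L) − 1)}` (shifted, with neighbours):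
* §D1 geometry: `one_le_RMhP`, `lev_shiftY_symm_le` (one step changes the level by `≤ 1`), `distT_blkOf_shiftY_symm_le_one`, `distT_shiftY_symm_ge`, `srcSet_facts`
  (the source set `Δ(s) ∪ (Δ(s)+e_μ)`: support, `ρ⁺_s = 0`, levels `≤ lev s + 1`).
* §D2 ★★ `hs_restrict_cdS_GsqY_parSymY_le_distT` ((3.46b): `≤ 160·L^{2 lev s}∕W²·‖Ψ‖²`), ★★ `hs_restrict_cdS_GsqY_cdsS_le_distT` ((3.46e): `≤ 10∕W²·‖λ‖²`),
  ★★★ `hs_restrict_cdS_cutMulY_GsqY_cutMulY_cdsS_le_distT` (the sandwiched mixed member, file 22's constant at `j_B = lev s + 1`),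
  ★★★ `hs_block_KhY_GsqY_cutMulY_cdsS_le_distT` (the `K(h_□)`-factor from `Δ(s)` to `Δ(t)`, file 23's constant at `j_A = j′_A = lev t`, `j_B = lev s + 1`).
MODEL ∕ SCOPE.  As files 19–23; exponents BY NAME (`msRhoT`: dag-n06-j `B6AgmonExponentMultiLevelTorus` ∕ `B9Thm31SiteAgmonExponentY`; `ρ⁺`: dag-n06-w7 `B9Eq346GradGpDivTorusL2`).
NOT HERE: the cut-off instantiation `h = hTY c` ([B6] p.247 sizes: lit-balaban), `D = cubeDomY`, the coordinate∕block-`L²` reading (FILE C).  NON-VACUITY (A6): as file 20.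
HONEST SCOPE: instantiation bookkeeping over landed estimates; NOT a node discharge, NOT summit progress; count-neutral; nothing continuum ∕ OS ∕ mass gap ∕ Clay.  NEW file
importing file 23 and `B9Eq346GradGpDivTorusL2` only.  Net new unproved facts: 0.
-/

noncomputable section

namespace Literature.MathematicalPhysics.QuantumFieldTheory.Balaban1983to89.B9Thm31SiteGsqBlockDistReg335Y

open Literature.MathematicalPhysics.QuantumFieldTheory.Balaban1983to89
open Node00 B6KLevelCensusIndexV1 B6Geom246MultiLevelBox B6MultiLevelBoxOperator B6MultiLevelTorusOperator B6GlobalChartV1 B9BackgroundsKLevelV1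
  B9Eq39Adjoint B9Thm311ReadingCoords B9Thm311DeltaPrimePos B9Ineq369CurvatureSmallAtLettersY B9Thm31SiteCoerciveGaugeBlockY B9Thm31SiteCoerciveReg335Y
  B9Thm31SiteGpBoundsReg335Y B9Thm31SitePolarisedFormY B9Thm31SiteConjugatedFormY B9Thm31SiteGpDecayReg335Y B9Thm31SiteAgmonWeightY B9Thm31SiteAgmonExponentY
  B9Thm31SiteGpGradDecayReg335Y B9Thm31SiteGpDivDecayReg335Y B9Thm31SiteGradGpDivDecayReg335Y Node00.OpsYLocalInverse B9Thm311LocalInversePosY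
  B9Thm31SiteGsqBoundsReg335Y B9Thm31SiteGsqDecayReg335Y B9Thm31SiteGsqGradDecayReg335Y B9Thm31SiteGsqCutoffMixedReg335Y B9Thm31SiteGsqCutoffFactorsReg335Y
  B6Geom246MultiLevelTorus B6TorusSiteWalks B6AgmonExponentMultiLevelTorus B4TorusKernel.MultiPeriod
open Literature.MathematicalPhysics.QuantumFieldTheory.Balaban1983to89.B9Eq346GradGpDivTorusL2 (msRhoYPos_bond msRhoYPos_bond' msRhoYPos_block msRhoYPos_eq_zero msRhoYPos_eq_zero_shift msRhoYPos_ge msRhoYPos_ge_of_le)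
open Literature.MathematicalPhysics.QuantumFieldTheory.Balaban1983to89.B9Thm37CubeCoverCommutatorSizes (torusSupNorm_sub_tshift_le_one)
open Literature.MathematicalPhysics.QuantumFieldTheory.Balaban1983to89.B9Thm37CubeCoverCommutators (cutMulY cutMulY_apply KhY)
open scoped Matrix Matrix.Norms.L2Operator

variable {d ℓ : ℕ} {hd : 1 ≤ d + 1} {hL : Odd (ℓ + 1) ∧ 1 < ℓ + 1} {b₀ b₁ : ℝ}
variable (i : KIdx d ℓ hd hL b₀ b₁) {N : ℕ} {G : Subgroup (Matrix (Fin N) (Fin N) ℂ)ˣ}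

section BlockDist

/-! ## §D1 Side conditions and the source set «block `s` thickened by one backward bond» -/

/-- `1 ≤ R`, `1 ≤ M_h`, `1 ≤ P′_μ` at the V1 index. [cite: Balaban1984PropagatorsII, (2.1)–(2.2) p.224, bookkeeping] -/
theorem one_le_RMhP : 1 ≤ i.R ∧ 1 ≤ i.Mh ∧ ∀ μ, 1 ≤ i.P' μ :=
  ⟨le_trans (Nat.one_le_iff_ne_zero.2 (Nat.mul_ne_zero_iff.2 ⟨by norm_num, (Nat.pow_pos (by omega)).ne'⟩)) i.hR2,
    le_trans (by norm_num) i.hM8, fun μ => le_trans (by norm_num) (i.hP5 μ)⟩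

/-- the level of the block of a site one lattice step away exceeds the level at the site by at most one.
[cite: Balaban1984PropagatorsII, (2.2) p.224] -/
theorem lev_shiftY_symm_le (μ : Fin (d + 1)) (z : SiteY i) :
    (blkOf i.D.toDomains ((shiftY i μ).symm z)).1.1 ≤ (blkOf i.D.toDomains z).1.1 + 1 := by
  obtain ⟨hR, hMh, _⟩ := one_le_RMhP i
  have h1 : torusSupNorm (toKT i).NB (z.1 - ((shiftY i μ).symm z).1) ≤ 1 := by
    have e : (shiftY i μ).symm z = tshift (toKT i).NB ((-1 : ℤ) • unitVec μ) z := by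
      rw [neg_one_smul]; exact tshift_symm_apply _ _ _
    rw [e]; exact torusSupNorm_sub_tshift_le_one z μ (-1) (Or.inr rfl)
  have h := lev_le_succ_of_torusSupNorm_le_one i.D hR hMh h1
  have e1 : i.D.lev ((shiftY i μ).symm z).1 = (blkOf i.D.toDomains ((shiftY i μ).symm z)).1.1 := lev_eq_of_blkOf_eq i.D.toDomains rfl
  have e0 : i.D.lev z.1 = (blkOf i.D.toDomains z).1.1 := lev_eq_of_blkOf_eq i.D.toDomains rfl
  rw [e1, e0] at h
  exact h

/-- the block of a backward neighbour is at block distance `≤ 1`. [cite: Balaban1984PropagatorsII, (2.46) p.231, bookkeeping] -/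
theorem distT_blkOf_shiftY_symm_le_one (μ : Fin (d + 1)) (z : SiteY i) :
    (bondT i.D).dist (blkOf i.D.toDomains z) (blkOf i.D.toDomains ((shiftY i μ).symm z)) ≤ 1 := by
  obtain ⟨_, hMh, hP⟩ := one_le_RMhP i
  by_cases he : (shiftY i μ).symm z = z
  · rw [he, SimpleGraph.dist_self]; exact zero_le_one
  · have hadj : (latGraphT (toKT i).NB).Adj z ((shiftY i μ).symm z) :=
      latGraphT_adj.2 ⟨Ne.symm he, Or.inr ⟨μ, ((shiftY i μ).apply_symm_apply z).symm⟩⟩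
    exact distT_blkOf_le_one_of_adj i.D hMh hP hadj

/-- hence the backward neighbours of sites in blocks at distance `≥ n` from `s` lie in blocks at distance `≥ n − 1`.
[cite: Balaban1984PropagatorsII, (2.46) p.231, bookkeeping] -/
theorem distT_shiftY_symm_ge (s : BlkY i) (μ : Fin (d + 1)) (z : SiteY i) {n : ℕ} (hn : n ≤ (bondT i.D).dist (blkOf i.D.toDomains z) s) :
    n - 1 ≤ (bondT i.D).dist (blkOf i.D.toDomains ((shiftY i μ).symm z)) s := by
  obtain ⟨_, hMh, hP⟩ := one_le_RMhP i
  have htri := (connectedT (D := i.D) hMh hP).dist_triangle (u := blkOf i.D.toDomains z) (v := blkOf i.D.toDomains ((shiftY i μ).symm z)) (w := s)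
  have h1 := distT_blkOf_shiftY_symm_le_one i μ z
  omega

/-! ## §D2 The members of files 21–23 with print's rate in the BLOCK DISTANCE (source block `s`, output in blocks at distance `≥ n`) -/

variable [Nonempty (Fin N)]

/-- ★★ **(3.46b) FOR `G′_□(U)` AT THE MULTI-SCALE EXPONENT**: for `Ψ` carried by the block `s` and `A` in blocks at block distance `≥ n` from `s`,
`Σ_{z∈A}Σ_μ HS((∇_{U,μ}G′_□(U)Ψ)(z)) ≤ 160·(L^{lev s})²·‖Ψ‖²₁ ∕ (e^{δ₀(n−1)∕(2L)})²`, `δ₀ = 1∕(4(d+2))`, uniformly in the member, `k`, `N`, `U`, □.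
[cite: Balaban1985BackgroundPropagators, Cor 3.6 p.408, Thm 3.1 (3.46) p.398, p.397; Balaban1984PropagatorsII, (2.46) p.231; Agmon1982, Ch.1, Thm 1.5] -/
theorem hs_restrict_cdS_GsqY_parSymY_le_distT (hG : G ≤ B7Prop2Explicit.unitaryUnits (Matrix (Fin N) (Fin N) ℂ))
    {U : CfgY (Matrix (Fin N) (Fin N) ℂ) i} {c α₀ : ℝ} (hC0 : 0 ≤ c * (kGeo i).M * α₀) (hC1 : c * (kGeo i).M * α₀ * ((d : ℝ) + 1) ≤ 1 / 16)
    (hreg : (bg9K (Matrix (Fin N) (Fin N) ℂ) G i).Reg335 c α₀ U) (D : Finset (SiteY i)) (s : BlkY i)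
    {A : Finset (SiteY i)} {Ψ : SiteY i → Matrix (Fin N) (Fin N) ℂ} (hΨ : ∀ z, blkOf i.D.toDomains z ≠ s → Ψ z = 0)
    {n : ℕ} (hA : ∀ z ∈ A, n ≤ (bondT i.D).dist (blkOf i.D.toDomains z) s) :
    ∑ z ∈ A, ∑ μ : Fin (d + 1), ∑ a, ∑ b, ‖cdS i U μ (GsqY i (parSymY i) D U Ψ) z a b‖ ^ 2
      ≤ 160 * (((((ℓ + 1) ^ s.1.1 : ℕ) : ℝ)) ^ 2 / Real.exp ((1 / (4 * ((d : ℝ) + 2))) * ((((n : ℝ)) - 1) / (2 * ((ℓ + 1 : ℕ) : ℝ)))) ^ 2)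
          * trIP (fun _ => (1 : ℝ)) Ψ Ψ := by
  classical
  set B : Finset (SiteY i) := Finset.univ.filter (fun z => blkOf i.D.toDomains z = s) with hB
  have hΨB : ∀ z, z ∉ B → Ψ z = 0 := fun z hz => hΨ z (by simpa [hB] using hz)
  have hρB : ∀ z ∈ B, msRhoT i.D s z = 0 := fun z hz => msRhoY_eq_zero i (by simpa [hB] using hz)
  have hjB : ∀ z ∈ B, (blkOf i.D.toDomains z).1.1 ≤ s.1.1 := fun z hz => by
    have h : blkOf i.D.toDomains z = s := by simpa [hB] using hz
    rw [h]
  exact hs_restrict_cdS_GsqY_parSymY_le_exp_canonical i hG hC0 hC1 hreg D (ρ := msRhoT i.D s) (msRhoY_bond i s) (msRhoY_bond' i s)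
    (msRhoY_block i s) hΨB hρB hjB (msRhoY_ge_of_le i s hA)

/-- ★★ **(3.46e) FOR `G′_□(U)` AT THE SHIFTED MULTI-SCALE EXPONENT** (dag-n06-w7's `ρ⁺_s = max(ρ_s − 1, 0)`): for `λ` carried by the block `s`, `A` in blocks at
block distance `≥ n` from `s` and every direction `μ`, `Σ_{z∈A}Σ_ν HS((∇_{U,ν}G′_□(U)∇\*_{U,μ}λ)(z)) ≤ 10·‖λ‖²₁ ∕ (e^{δ₀((n−1)∕(2L) − 1)})²`.
[cite: Balaban1985BackgroundPropagators, Cor 3.6 p.408, Thm 3.1 (3.46) p.398; Balaban1984PropagatorsII, (2.46) p.231; Agmon1982, Ch.1, Thm 1.5] -/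
theorem hs_restrict_cdS_GsqY_cdsS_le_distT (hG : G ≤ B7Prop2Explicit.unitaryUnits (Matrix (Fin N) (Fin N) ℂ))
    {U : CfgY (Matrix (Fin N) (Fin N) ℂ) i} {c α₀ : ℝ} (hC0 : 0 ≤ c * (kGeo i).M * α₀) (hC1 : c * (kGeo i).M * α₀ * ((d : ℝ) + 1) ≤ 1 / 16)
    (hreg : (bg9K (Matrix (Fin N) (Fin N) ℂ) G i).Reg335 c α₀ U) (D : Finset (SiteY i)) (μ : Fin (d + 1)) (s : BlkY i)
    {A : Finset (SiteY i)} {Λ : SiteY i → Matrix (Fin N) (Fin N) ℂ} (hΛ : ∀ z, blkOf i.D.toDomains z ≠ s → Λ z = 0)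
    {n : ℕ} (hA : ∀ z ∈ A, n ≤ (bondT i.D).dist (blkOf i.D.toDomains z) s) :
    ∑ z ∈ A, ∑ ν : Fin (d + 1), ∑ a, ∑ b, ‖cdS i U ν (GsqY i (parSymY i) D U (cdsS i U μ Λ)) z a b‖ ^ 2
      ≤ 10 * trIP (fun _ => (1 : ℝ)) Λ Λ / Real.exp ((1 / (4 * ((d : ℝ) + 2))) * (((((n : ℝ)) - 1) / (2 * ((ℓ + 1 : ℕ) : ℝ)) - 1))) ^ 2 := by
  classical
  set B : Finset (SiteY i) := Finset.univ.filter (fun z => blkOf i.D.toDomains z = s ∨ blkOf i.D.toDomains ((shiftY i μ).symm z) = s) with hB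
  have hv : ∀ z, z ∉ B → cdsS i U μ Λ z = 0 := by
    intro z hz
    rw [hB, Finset.mem_filter, not_and] at hz
    have hz' := hz (Finset.mem_univ z)
    rw [not_or] at hz'
    show R (UboxY i U μ ((shiftY i μ).symm z))⁻¹ (Λ ((shiftY i μ).symm z)) - Λ z = 0
    rw [hΛ _ hz'.2, hΛ _ hz'.1, R_zero, sub_zero]
  have hρB : ∀ z ∈ B, max (msRhoT i.D s z - 1) 0 = 0 := by
    intro z hz
    rw [hB, Finset.mem_filter] at hz
    rcases hz.2 with h | h
    · exact msRhoYPos_eq_zero i h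
    · have e : z = shiftY i μ ((shiftY i μ).symm z) := ((shiftY i μ).apply_symm_apply z).symm
      rw [e]
      exact msRhoYPos_eq_zero_shift i μ h
  exact hs_restrict_cdS_GsqY_cdsS_le_exp_canonical i hG hC0 hC1 hreg D (ρ := fun z => max (msRhoT i.D s z - 1) 0) (msRhoYPos_bond i s)
    (msRhoYPos_bond' i s) (msRhoYPos_block i s) μ hv hρB (msRhoYPos_ge_of_le i s hA)

omit [Nonempty (Fin N)] in
/-- the common hypotheses of the sandwiched members at the shifted exponent: with `B = Δ(s) ∪ (Δ(s) + e_μ)` and `ω = e^{δ₀ρ⁺_s}`, file 22∕23's weight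
binders hold with `θ_b = 2δ₀²`, `θ_s = 2δ₀²(d+1)²`, levels `≤ lev s + 1` on `B`, and `W = e^{δ₀((n−1)∕(2L) − 1)}` on blocks at distance `≥ n`.  We record the
three data facts the instantiations below share. [cite: Balaban1985BackgroundPropagators, (3.46) p.398, p.397; Balaban1984PropagatorsII, (2.2) p.224, (2.46) p.231] -/
theorem srcSet_facts (μ : Fin (d + 1)) (s : BlkY i) {Λ : SiteY i → Matrix (Fin N) (Fin N) ℂ} (hΛ : ∀ z, blkOf i.D.toDomains z ≠ s → Λ z = 0) :
    let B : Finset (SiteY i) := Finset.univ.filter (fun z => blkOf i.D.toDomains z = s ∨ blkOf i.D.toDomains ((shiftY i μ).symm z) = s)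
    (∀ z, z ∉ B → Λ z = 0) ∧ (∀ z, z ∉ B → Λ ((shiftY i μ).symm z) = 0) ∧ (∀ z ∈ B, max (msRhoT i.D s z - 1) 0 = 0)
      ∧ (∀ z ∈ B, (blkOf i.D.toDomains z).1.1 ≤ s.1.1 + 1) := by
  classical
  intro B
  have hmem : ∀ z, z ∉ B → blkOf i.D.toDomains z ≠ s ∧ blkOf i.D.toDomains ((shiftY i μ).symm z) ≠ s := by
    intro z hz
    have hz' : ¬ (blkOf i.D.toDomains z = s ∨ blkOf i.D.toDomains ((shiftY i μ).symm z) = s) := by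
      simpa [B] using hz
    exact not_or.1 hz'
  refine ⟨fun z hz => hΛ z (hmem z hz).1, fun z hz => hΛ _ (hmem z hz).2, fun z hz => ?_, fun z hz => ?_⟩
  · have hz' : blkOf i.D.toDomains z = s ∨ blkOf i.D.toDomains ((shiftY i μ).symm z) = s := by simpa [B] using hz
    rcases hz' with h | h
    · exact msRhoYPos_eq_zero i h
    · have e : z = shiftY i μ ((shiftY i μ).symm z) := ((shiftY i μ).apply_symm_apply z).symm
      rw [e]; exact msRhoYPos_eq_zero_shift i μ h
  · have hz' : blkOf i.D.toDomains z = s ∨ blkOf i.D.toDomains ((shiftY i μ).symm z) = s := by simpa [B] using hz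
    rcases hz' with h | h
    · rw [h]; exact Nat.le_succ _
    · -- `z = w + e_μ` with `w := (σ_μ)⁻¹ z ∈ Δ(s)`: `lev z ≤ lev w + 1`
      obtain ⟨hR, hMh, _⟩ := one_le_RMhP i
      set w := (shiftY i μ).symm z with hw
      have hz : shiftY i μ w = z := (shiftY i μ).apply_symm_apply z
      have e2 : shiftY i μ w = tshift (toKT i).NB ((1 : ℤ) • unitVec μ) w := by rw [one_smul]; rfl
      have h1 := torusSupNorm_sub_tshift_le_one w μ 1 (Or.inl rfl)
      rw [← e2, hz] at h1
      have h4 := lev_le_succ_of_torusSupNorm_le_one i.D hR hMh h1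
      have e1 : i.D.lev w.1 = (blkOf i.D.toDomains w).1.1 := lev_eq_of_blkOf_eq i.D.toDomains rfl
      have e0 : i.D.lev z.1 = (blkOf i.D.toDomains z).1.1 := lev_eq_of_blkOf_eq i.D.toDomains rfl
      rw [e1, e0, h] at h4
      exact h4

/-- ★★★ **THE SANDWICHED MIXED MEMBER AT THE SHIFTED MULTI-SCALE EXPONENT**: on the class, ANY `D`, ANY real cut-off `h` with `|h| ≤ 1` and bond differences `≤ κ`, for
`λ` carried by the block `s` and `A` in blocks at block distance `≥ n` from `s` with levels `≤ j_A`,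
`Σ_{z∈A} HS((∇_{U,ν}M_hG′_□(U)M_h∇*_{U,μ}λ)(z)) ≤ 4·(10 + κ²(16L^{2j_A} + 160L^{2(lev s+1)}) + 256κ⁴L^{2j_A}L^{2(lev s+1)}) · ‖λ‖²₁ ∕ (e^{δ₀((n−1)∕(2L) − 1)})²`.
[cite: Balaban1985BackgroundPropagators, Cor 3.6 p.408, (3.46) p.398, (3.87)–(3.89) p.409; Balaban1984PropagatorsII, (2.39)–(2.44) pp.229–230, (2.46) p.231; Agmon1982, Ch.1, Thm 1.5] -/
theorem hs_restrict_cdS_cutMulY_GsqY_cutMulY_cdsS_le_distT (hG : G ≤ B7Prop2Explicit.unitaryUnits (Matrix (Fin N) (Fin N) ℂ))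
    {U : CfgY (Matrix (Fin N) (Fin N) ℂ) i} {c α₀ : ℝ} (hC0 : 0 ≤ c * (kGeo i).M * α₀) (hC1 : c * (kGeo i).M * α₀ * ((d : ℝ) + 1) ≤ 1 / 16)
    (hreg : (bg9K (Matrix (Fin N) (Fin N) ℂ) G i).Reg335 c α₀ U) (D : Finset (SiteY i))
    {h : SiteY i → ℝ} {κ : ℝ} (hh1 : ∀ z, |h z| ≤ 1) (hhκ : ∀ μ z, |h (shiftY i μ z) - h z| ≤ κ) (ν μ : Fin (d + 1)) (s : BlkY i)
    {A : Finset (SiteY i)} {Λ : SiteY i → Matrix (Fin N) (Fin N) ℂ} (hΛ : ∀ z, blkOf i.D.toDomains z ≠ s → Λ z = 0)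
    {n : ℕ} (hA : ∀ z ∈ A, n ≤ (bondT i.D).dist (blkOf i.D.toDomains z) s) {jA : ℕ} (hjA : ∀ z ∈ A, (blkOf i.D.toDomains z).1.1 ≤ jA) :
    ∑ z ∈ A, ∑ a, ∑ b, ‖cdS i U ν (cutMulY h (GsqY i (parSymY i) D U (cutMulY h (cdsS i U μ Λ)))) z a b‖ ^ 2
      ≤ 4 * (10 + κ ^ 2 * (16 * ((((ℓ + 1) ^ jA : ℕ) : ℝ)) ^ 2 + 160 * ((((ℓ + 1) ^ (s.1.1 + 1) : ℕ) : ℝ)) ^ 2)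
          + 256 * κ ^ 4 * (((((ℓ + 1) ^ jA : ℕ) : ℝ)) ^ 2 * ((((ℓ + 1) ^ (s.1.1 + 1) : ℕ) : ℝ)) ^ 2))
        / Real.exp ((1 / (4 * ((d : ℝ) + 2))) * (((((n : ℝ)) - 1) / (2 * ((ℓ + 1 : ℕ) : ℝ)) - 1))) ^ 2 * trIP (fun _ => (1 : ℝ)) Λ Λ := by
  classical
  obtain ⟨hΛB, hΛB', hρB, hjB⟩ := srcSet_facts i μ s hΛ
  have hd0 : (0 : ℝ) ≤ d := Nat.cast_nonneg d
  have hd2 : (0 : ℝ) < 4 * ((d : ℝ) + 2) := by positivity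
  have hδ0 : (0 : ℝ) ≤ 1 / (4 * ((d : ℝ) + 2)) := by positivity
  have hδ1 : 1 / (4 * ((d : ℝ) + 2)) ≤ 1 := by rw [div_le_one hd2]; linarith
  have hδD : 1 / (4 * ((d : ℝ) + 2)) * ((d : ℝ) + 1) ≤ 1 := by rw [div_mul_eq_mul_div, one_mul, div_le_one hd2]; linarith
  have hδκ0 : (1 / (4 * ((d : ℝ) + 2))) ^ 2 * (2 * ((d : ℝ) + 1) + ((d : ℝ) + 1) ^ 2) ≤ 1 / 16 := by
    rw [div_pow, one_pow, mul_pow, one_div_mul_eq_div, div_le_iff₀ (by positivity)]; nlinarith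
  have hδκ : ((d : ℝ) + 1) * (2 * (1 / (4 * ((d : ℝ) + 2))) ^ 2) + (2 * (1 / (4 * ((d : ℝ) + 2))) ^ 2 * ((d : ℝ) + 1) ^ 2) / 2 ≤ 1 / 16 := by
    have e : ((d : ℝ) + 1) * (2 * (1 / (4 * ((d : ℝ) + 2))) ^ 2) + (2 * (1 / (4 * ((d : ℝ) + 2))) ^ 2 * ((d : ℝ) + 1) ^ 2) / 2
        = (1 / (4 * ((d : ℝ) + 2))) ^ 2 * (2 * ((d : ℝ) + 1) + ((d : ℝ) + 1) ^ 2) := by ring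
    rw [e]; exact hδκ0
  set ρ : SiteY i → ℝ := fun z => max (msRhoT i.D s z - 1) 0 with hρ
  have hω : ∀ z, 0 < Real.exp (1 / (4 * ((d : ℝ) + 2)) * ρ z) := fun z => Real.exp_pos _
  have hωB : ∀ z ∈ Finset.univ.filter (fun z => blkOf i.D.toDomains z = s ∨ blkOf i.D.toDomains ((shiftY i μ).symm z) = s),
      Real.exp (1 / (4 * ((d : ℝ) + 2)) * ρ z) = 1 := fun z hz => by rw [hρ]; simp only []; rw [hρB z hz, mul_zero, Real.exp_zero]
  have hW : ∀ z ∈ A, Real.exp (1 / (4 * ((d : ℝ) + 2)) * (((((n : ℝ)) - 1) / (2 * ((ℓ + 1 : ℕ) : ℝ)) - 1))) ≤ Real.exp (1 / (4 * ((d : ℝ) + 2)) * ρ z) :=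
    fun z hz => Real.exp_le_exp.2 (mul_le_mul_of_nonneg_left (msRhoYPos_ge_of_le i s hA z hz) hδ0)
  have key := hs_restrict_cdS_cutMulY_GsqY_cutMulY_cdsS_le i hG hC0 hC1 hreg D hω (by positivity) (by positivity)
    (fun μ' z => bondRatio_exp_le i hδ0 hδ1 μ' z (msRhoYPos_bond i s μ' z)) (fun μ' z => bondRatio_exp_le' i hδ0 hδ1 μ' z (msRhoYPos_bond' i s μ' z))
    (fun z w hzw => blockOsc_exp_le i hδ0 hδD z w (msRhoYPos_block i s z w hzw)) hδκ hh1 hhκ ν μ hΛB hΛB' hωB hjA hjB (Real.exp_pos _) hW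
  exact key


/-- ★★★ **THE `K(h_□)`-FACTOR AT THE SHIFTED MULTI-SCALE EXPONENT, BLOCK TO BLOCK**: on the class, ANY `D`, ANY real cut-off `h` (`|h| ≤ 1`, bond differences `≤ κ`, axis
second differences `≤ κ₂`, block oscillation `≤ κ_b`), for `λ` carried by the block `s` and the OUTPUT BLOCK `t` at block distance `≥ n` from `s`:
`Σ_{z∈Δ(t)} HS((K(h)(U) G′_□(U) M_h ∇*_{U,μ} λ)(z)) ≤ [16(d+1)(d+2)κ²(10 + 160κ²L^{2(lev s+1)}) + (8(d+1)²κ₂² + 4κ_b²L^{−4 lev t})(16 + 256κ²L^{2(lev s+1)})L^{2 lev t}]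
· ‖λ‖²₁ ∕ (e^{δ₀((n−2)∕(2L) − 1)})²` (the weight floor is read one step behind `Δ(t)`, on blocks at distance `≥ n − 1`).
[cite: Balaban1985BackgroundPropagators, (3.88)–(3.89) p.409, Cor 3.6 p.408, (3.46) p.398; Balaban1984PropagatorsII, (2.40)–(2.44) p.230, (2.46) p.231, p.247; Agmon1982, Ch.1, Thm 1.5] -/
theorem hs_block_KhY_GsqY_cutMulY_cdsS_le_distT (hG : G ≤ B7Prop2Explicit.unitaryUnits (Matrix (Fin N) (Fin N) ℂ))
    {U : CfgY (Matrix (Fin N) (Fin N) ℂ) i} {c α₀ : ℝ} (hC0 : 0 ≤ c * (kGeo i).M * α₀) (hC1 : c * (kGeo i).M * α₀ * ((d : ℝ) + 1) ≤ 1 / 16)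
    (hreg : (bg9K (Matrix (Fin N) (Fin N) ℂ) G i).Reg335 c α₀ U) (D : Finset (SiteY i))
    {h : SiteY i → ℝ} {κ κ₂ κb : ℝ} (hh1 : ∀ z, |h z| ≤ 1) (hhκ : ∀ μ z, |h (shiftY i μ z) - h z| ≤ κ)
    (hhκ₂ : ∀ μ z, |h (shiftY i μ z) + h ((shiftY i μ).symm z) - 2 * h z| ≤ κ₂)
    (hhb : ∀ z w : SiteY i, blkOf i.D.toDomains w = blkOf i.D.toDomains z → |h z - h w| ≤ κb) (μ : Fin (d + 1)) (s t : BlkY i)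
    {Λ : SiteY i → Matrix (Fin N) (Fin N) ℂ} (hΛ : ∀ z, blkOf i.D.toDomains z ≠ s → Λ z = 0) {n : ℕ} (hn : n ≤ (bondT i.D).dist t s) :
    ∑ z ∈ Finset.univ.filter (fun z => blkOf i.D.toDomains z = t), ∑ a, ∑ b, ‖KhY i (parSymY i) h U (GsqY i (parSymY i) D U (cutMulY h (cdsS i U μ Λ))) z a b‖ ^ 2
      ≤ (16 * ((d : ℝ) + 1) * ((d : ℝ) + 2) * κ ^ 2 * (10 + 160 * κ ^ 2 * ((((ℓ + 1) ^ (s.1.1 + 1) : ℕ) : ℝ)) ^ 2)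
          + (8 * (((d : ℝ) + 1) * κ₂) ^ 2 + 4 * κb ^ 2 * ((((((ℓ + 1) ^ t.1.1 : ℕ) : ℝ)) ^ 2)⁻¹) ^ 2)
            * ((16 + 256 * κ ^ 2 * ((((ℓ + 1) ^ (s.1.1 + 1) : ℕ) : ℝ)) ^ 2) * ((((ℓ + 1) ^ t.1.1 : ℕ) : ℝ)) ^ 2))
        / Real.exp ((1 / (4 * ((d : ℝ) + 2))) * (((((n : ℝ)) - 2) / (2 * ((ℓ + 1 : ℕ) : ℝ)) - 1))) ^ 2 * trIP (fun _ => (1 : ℝ)) Λ Λ := by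
  classical
  obtain ⟨hΛB, hΛB', hρB, hjB⟩ := srcSet_facts i μ s hΛ
  set A : Finset (SiteY i) := Finset.univ.filter (fun z => blkOf i.D.toDomains z = t) with hAdef
  have hAmem : ∀ z, z ∈ A ↔ blkOf i.D.toDomains z = t := fun z => by simp [hAdef]
  have hd0 : (0 : ℝ) ≤ d := Nat.cast_nonneg d
  have hd2 : (0 : ℝ) < 4 * ((d : ℝ) + 2) := by positivity
  have hδ0 : (0 : ℝ) ≤ 1 / (4 * ((d : ℝ) + 2)) := by positivity
  have hδ1 : 1 / (4 * ((d : ℝ) + 2)) ≤ 1 := by rw [div_le_one hd2]; linarith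
  have hδD : 1 / (4 * ((d : ℝ) + 2)) * ((d : ℝ) + 1) ≤ 1 := by rw [div_mul_eq_mul_div, one_mul, div_le_one hd2]; linarith
  have hδκ0 : (1 / (4 * ((d : ℝ) + 2))) ^ 2 * (2 * ((d : ℝ) + 1) + ((d : ℝ) + 1) ^ 2) ≤ 1 / 16 := by
    rw [div_pow, one_pow, mul_pow, one_div_mul_eq_div, div_le_iff₀ (by positivity)]; nlinarith
  have hδκ : ((d : ℝ) + 1) * (2 * (1 / (4 * ((d : ℝ) + 2))) ^ 2) + (2 * (1 / (4 * ((d : ℝ) + 2))) ^ 2 * ((d : ℝ) + 1) ^ 2) / 2 ≤ 1 / 16 := by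
    have e : ((d : ℝ) + 1) * (2 * (1 / (4 * ((d : ℝ) + 2))) ^ 2) + (2 * (1 / (4 * ((d : ℝ) + 2))) ^ 2 * ((d : ℝ) + 1) ^ 2) / 2
        = (1 / (4 * ((d : ℝ) + 2))) ^ 2 * (2 * ((d : ℝ) + 1) + ((d : ℝ) + 1) ^ 2) := by ring
    rw [e]; exact hδκ0
  set ρ : SiteY i → ℝ := fun z => max (msRhoT i.D s z - 1) 0 with hρ
  have hω : ∀ z, 0 < Real.exp (1 / (4 * ((d : ℝ) + 2)) * ρ z) := fun z => Real.exp_pos _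
  have hωB : ∀ z ∈ Finset.univ.filter (fun z => blkOf i.D.toDomains z = s ∨ blkOf i.D.toDomains ((shiftY i μ).symm z) = s),
      Real.exp (1 / (4 * ((d : ℝ) + 2)) * ρ z) = 1 := fun z hz => by rw [hρ]; simp only []; rw [hρB z hz, mul_zero, Real.exp_zero]
  -- the weight floor on `Δ(t)` and one step behind it: blocks at distance `≥ n − 1`
  set r : ℝ := ((((n : ℝ)) - 2) / (2 * ((ℓ + 1 : ℕ) : ℝ)) - 1) with hr
  have hLpos : (0 : ℝ) < 2 * ((ℓ + 1 : ℕ) : ℝ) := by positivity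
  have hfloor : ∀ w : SiteY i, n - 1 ≤ (bondT i.D).dist (blkOf i.D.toDomains w) s → r ≤ ρ w := by
    intro w hw
    refine le_trans ?_ (msRhoYPos_ge i s w)
    have h1 : ((n : ℝ)) - 2 ≤ ((bondT i.D).dist (blkOf i.D.toDomains w) s : ℝ) - 1 := by
      have h2 : ((n - 1 : ℕ) : ℝ) ≤ ((bondT i.D).dist (blkOf i.D.toDomains w) s : ℝ) := by exact_mod_cast hw
      have h3 : ((n : ℝ)) - 1 ≤ ((n - 1 : ℕ) : ℝ) := by
        rcases Nat.eq_zero_or_pos n with h0 | hpos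
        · simp [h0]
        · rw [Nat.cast_sub hpos]; simp
      linarith
    exact sub_le_sub_right (div_le_div_of_nonneg_right h1 hLpos.le) 1
  have hW : ∀ z ∈ A, Real.exp (1 / (4 * ((d : ℝ) + 2)) * r) ≤ Real.exp (1 / (4 * ((d : ℝ) + 2)) * ρ z) := by
    intro z hz
    refine Real.exp_le_exp.2 (mul_le_mul_of_nonneg_left (hfloor z ?_) hδ0)
    rw [(hAmem z).1 hz]; omega
  have hW' : ∀ ν, ∀ z ∈ A, Real.exp (1 / (4 * ((d : ℝ) + 2)) * r) ≤ Real.exp (1 / (4 * ((d : ℝ) + 2)) * ρ ((shiftY i ν).symm z)) := by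
    intro ν z hz
    refine Real.exp_le_exp.2 (mul_le_mul_of_nonneg_left (hfloor _ ?_) hδ0)
    have h1 := distT_shiftY_symm_ge i s ν z (n := n) (by rw [(hAmem z).1 hz]; exact hn)
    exact h1
  have hAblk : ∀ z ∈ A, ∀ w, blkOf i.D.toDomains w = blkOf i.D.toDomains z → w ∈ A := fun z hz w hw =>
    (hAmem w).2 (hw.trans ((hAmem z).1 hz))
  have hjA : ∀ z ∈ A, (blkOf i.D.toDomains z).1.1 ≤ t.1.1 := fun z hz => by rw [(hAmem z).1 hz]
  have hjA' : ∀ z ∈ A, t.1.1 ≤ (blkOf i.D.toDomains z).1.1 := fun z hz => by rw [(hAmem z).1 hz]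
  have key := hs_restrict_KhY_GsqY_cutMulY_cdsS_le i hG hC0 hC1 hreg D hω (by positivity) (by positivity)
    (fun μ' z => bondRatio_exp_le i hδ0 hδ1 μ' z (msRhoYPos_bond i s μ' z)) (fun μ' z => bondRatio_exp_le' i hδ0 hδ1 μ' z (msRhoYPos_bond' i s μ' z))
    (fun z w hzw => blockOsc_exp_le i hδ0 hδD z w (msRhoYPos_block i s z w hzw)) hδκ hh1 hhκ hhκ₂ hhb μ hAblk hΛB hΛB' hωB hjA hjA' hjB
    (Real.exp_pos _) hW hW'
  exact key


end BlockDist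

end Literature.MathematicalPhysics.QuantumFieldTheory.Balaban1983to89.B9Thm31SiteGsqBlockDistReg335Y
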